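import Literature.AlgebraicGeometry.HodgeTheory.ProjectiveZeroDimensionalHilbertFunction
import Literature.AlgebraicGeometry.HodgeTheory.CompleteIntersectionHilbertFunction
import Literature.AlgebraicGeometry.HodgeTheory.ProjectiveCompleteIntersectionBezout
import Literature.Algebra.Homology.LaurentCechGradedModuleGlobalSections
import Literature.Algebra.Homology.LaurentCechSubquotientHyperplaneSection
import HarnessLib

/-!
# The Cayley–Bacharach theorem for complete-intersection zero-schemes in `ℙ^r`

Eisenbud–Green–Harris, *Cayley–Bacharach theorems and conjectures* (Bull. AMS 33, 1996):
**Thm. CB4** "Let `X_1, X_2 ⊂ ℙ²` be plane curves of degrees `d` and `e` respectively, meeting in a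
collection of `d·e` distinct points `Γ`. If `C ⊂ ℙ²` is any plane curve of degree `d + e - 3`
containing all but one point of `Γ`, then `C` contains all of `Γ`" (CB3 = Chasles: `d = e = 3`);
**Thm. CB6/CB7** (hypersurfaces `X_1, …, X_n ⊂ ℙ^n` of degrees `d_i` meeting in a zero-dimensional
`Γ`, `s = Σ d_i - n - 1`, `Γ', Γ''` residual in `Γ`: "the dimension of the family of curves of degree
`k` containing `Γ'` (modulo those containing all of `Γ`) is equal to the failure of `Γ''` to impose
independent conditions of curves of complementary degree `s - k`"); **Thm. CB8** and §1.3: "the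
ring `A = S/(F_1, …, F_n, L)` is itself Gorenstein, with socle in degree `m`… Cayley–Bacharach thus
turns out to be simply the statement that the ring `A` is Gorenstein".

This file proves, in the tree's Čech language (`Literature/Algebra/Homology/LaurentCech*`; ideals
of `S = k[x₀, …, x_r]` as submodules of `S^{pt}`, `e = 0`; degree pieces `degPiece`, saturation
`sat`, Hilbert polynomials as `χ`-polynomials of `quot`), the case of CB7 in which the residual
scheme is a point — **a hypersurface of degree `≤ s = Σ d_i - r - 1` containing a colength-one
subscheme `Z'` of a complete-intersection zero-scheme `Z = V(f_1, …, f_r) ⊂ ℙ^r` contains `Z`** —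
for ARBITRARY (non-reduced) complete intersections over any infinite field, from Macaulay's theorem
that `S ⧸ (f_1, …, f_r, ℓ)` is Artinian Gorenstein of socle degree `σ = s + 1`
(`HodgeTheory/CompleteIntersectionHilbertFunction`, in the `MvPolynomial`-ideal language, bridged
here):

* (private) `mem_ideal_smul_top_iff`, `ofList_append_singleton_smul_top` — ideals of `S` vs
  submodules of `S^{pt}`;
* `const_mem_sup_smul_top_of_forall_mul` — the Gorenstein pairing of `S ⧸ (f_1, …, f_r, ℓ)` for
  `f_i` weakly regular on `S^{pt}` and `ℓ` a linear non-zero-divisor modulo `(f_1, …, f_r)S^{pt}`: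
  a form `g` of degree `a`, `a + b = σ`, with `g·S_b ⊆ (f, ℓ)` lies in `(f, ℓ)`;
* (private) `exists_sub_smul_mem_of_finrank_le` — linear algebra of a codimension-`≤ 1` subspace;
* **`degPiece_sat_eq_of_completeIntersection_colength_one`** — the theorem: `f_1, …, f_r` forms of
  positive degrees, weakly regular on `S^{pt}` (`r ≥ 1`, `k` infinite), `I_Z = (f_1, …, f_r)S^{pt}`
  with Hilbert polynomial `N`, `K' ⊇ I_Z` graded with Hilbert polynomial `N - 1`; then
  `(K̄')_n = (I_Z)_n` for every `n ≤ Σ d_i - r - 1`. Proof: `I_Z` is saturated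
  (`sat_ofList_smul_top_eq`); a linear `ℓ` regular modulo `I_Z` and `K̄'` exists
  (`exists_linearForm_regular_sat_pair`); `dim (K̄')_m - dim (I_Z)_m` is non-decreasing (`ℓ` acts
  injectively on `K̄' ⧸ I_Z`) with eventual value `N - (N - 1) = 1`, so `≤ 1`; by induction on `n`: for
  `g ∈ (K̄')_n`, `n ≤ s`, and every form `h` of degree `σ - n ≥ 1`, `g h ≡ c · g ℓ^{σ-n} (mod I_Z)`,
  hence `g·S_{σ-n} ⊆ (I_Z, ℓ)`, so `g ∈ (I_Z, ℓ)` by the pairing, `g = k₁ + ℓ v'` in degree `n` with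
  `ℓ v' ∈ K̄'`, `v' ∈ (K̄')_{n-1} = (I_Z)_{n-1}`, and `g ∈ I_Z`;
* `degPiece_sat_eq_of_completeIntersection_length_pred` — the same with `N = Π d_i` supplied by
  Bézout (`ProjectiveCompleteIntersectionBezout`);
* **`degPiece_sat_eq_of_planeCurves_length_pred`** — CB4 in the plane: `f, g` of degrees `d, e`
  without common factor, `Z' ⊂ V(f, g)` of length `d e - 1`: curves of degree `≤ d + e - 3` through
  `Z'` contain `V(f, g)`.

Theorems only; no definitions, no named facts. Not here: the general residual form CB7 (`Γ''` of
any degree; it needs the dualizing module of `Z`), and the converse CB9/Davis–Geramita–Orecchia.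

## References

* [EisenbudGreenHarris1996] D. Eisenbud, M. Green, J. Harris, *Cayley–Bacharach theorems and
  conjectures*, Bull. Amer. Math. Soc. 33 (1996), 295–324, Thms. CB3, CB4, CB6, CB7, CB8, §§1.3–1.4.
* [Hartshorne1977] R. Hartshorne, *Algebraic Geometry*, GTM 52 (1977), I Thm. 7.7 (p. 53),
  II Ex. 8.4 (p. 188), III Thm. 7.6.
* [SilvermanTate2015] J. H. Silverman, J. T. Tate, *Rational Points on Elliptic Curves*, 2nd ed.
  (2015), Appendix A, Thm. A.2 (pp. 232–234).
* [CarlsonMullerStachPeters2017] J. Carlson, S. Müller-Stach, C. Peters, *Period Mappings and Period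
  Domains*, 2nd ed. (2017), Thm. 7.4.1.
* [BrunsHerzog1998] W. Bruns, J. Herzog, *Cohen–Macaulay Rings*, Prop. 1.5.12.
-/

noncomputable section

open CategoryTheory CategoryTheory.Limits Polynomial Pointwise RingTheory.Sequence
open scoped Nat

universe u

namespace Literature.Algebra.Homology

namespace LaurentCech

open OrderedCech TopCohomology Literature.AlgebraicGeometry.DuqueFrancoVillaflor2025
  Literature.AlgebraicGeometry.HodgeTheory

variable {k : Type u} [Field k] {r : ℕ}

/-! ### Ideals of `S` versus submodules of the rank-one free module `S^{pt}` -/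

/-- `v ∈ I·S^{pt} ⟺ v(pt) ∈ I`. [folklore] -/
private theorem mem_ideal_smul_top_iff (I : Ideal (P k r)) (v : Unit → P k r) :
    v ∈ I • (⊤ : Submodule (P k r) (Unit → P k r)) ↔ v () ∈ I := by
  constructor
  · intro hv
    refine Submodule.smul_induction_on hv (fun a ha w _ => ?_) (fun x y hx hy => ?_)
    · rw [Pi.smul_apply, smul_eq_mul]
      exact I.mul_mem_right _ ha
    · rw [Pi.add_apply]
      exact I.add_mem hx hy
  · intro hv
    have : v = (v ()) • (fun _ : Unit => (1 : P k r)) := by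
      funext u
      rw [Pi.smul_apply, smul_eq_mul, mul_one]
    rw [this]
    exact Submodule.smul_mem_smul hv Submodule.mem_top

/-- `(I + (ℓ))·S^{pt} = I·S^{pt} + ℓ S^{pt}`. [folklore] -/
private theorem ofList_append_singleton_smul_top (l : List (P k r)) (ℓ : P k r) :
    Ideal.ofList (l ++ [ℓ]) • (⊤ : Submodule (P k r) (Unit → P k r)) =
      Ideal.ofList l • (⊤ : Submodule (P k r) (Unit → P k r)) ⊔ ℓ • ⊤ := by
  rw [Ideal.ofList_append, Submodule.sup_smul, Ideal.ofList_singleton,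
    Submodule.ideal_span_singleton_smul]

/-! ### The Gorenstein pairing of `S ⧸ (f_1, …, f_r, ℓ)` in the submodule language -/

/-- **Macaulay's theorem for `(f_1, …, f_r, ℓ)`, pairing form, in the language of submodules of
`S^{pt}`**: for forms `f_1, …, f_r` of positive degrees `d_i`, weakly regular on `S^{pt}`, and a
linear form `ℓ` which is a non-zero-divisor modulo `(f_1, …, f_r)S^{pt}`, the quotient
`S ⧸ (f_1, …, f_r, ℓ)` is Artinian Gorenstein of socle degree `σ = Σ (d_i - 1)`: a form `g` of degree
`a`, `a + b = σ`, with `g h ∈ (f_1, …, f_r, ℓ)` for every form `h` of degree `b`, lies in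
`(f_1, …, f_r, ℓ)`. [cite: EisenbudGreenHarris1996, Thm. CB8]
[cite: CarlsonMullerStachPeters2017, Thm. 7.4.1] -/
theorem const_mem_sup_smul_top_of_forall_mul (fs : List (P k r × ℕ)) (hlen : fs.length = r)
    (hhom : ∀ fc ∈ fs, fc.1.IsHomogeneous fc.2) (hpos : ∀ fc ∈ fs, 0 < fc.2)
    (hreg : IsWeaklyRegular (Unit → P k r) (fs.map Prod.fst)) {ℓ : P k r}
    (hℓ1 : ℓ.IsHomogeneous 1)
    (hℓreg : ∀ v : Unit → P k r,
      ℓ • v ∈ Ideal.ofList (fs.map Prod.fst) • (⊤ : Submodule (P k r) (Unit → P k r)) →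
        v ∈ Ideal.ofList (fs.map Prod.fst) • (⊤ : Submodule (P k r) (Unit → P k r)))
    {a b : ℕ} (hab : a + b + r = (fs.map Prod.snd).sum) {g : P k r} (hg : g.IsHomogeneous a)
    (H : ∀ h : P k r, h.IsHomogeneous b →
      (fun _ : Unit => g * h) ∈
        Ideal.ofList (fs.map Prod.fst) • (⊤ : Submodule (P k r) (Unit → P k r)) ⊔ ℓ • ⊤) :
    (fun _ : Unit => g) ∈
      Ideal.ofList (fs.map Prod.fst) • (⊤ : Submodule (P k r) (Unit → P k r)) ⊔ ℓ • ⊤ := by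
  -- the square system `G = (f_1, …, f_r, ℓ)` with degrees `d = (d_1, …, d_r, 1)`
  set fcs : List (P k r × ℕ) := fs ++ [(ℓ, 1)] with hfcs
  have hfcslen : fcs.length = r + 1 := by rw [hfcs, List.length_append, hlen]; rfl
  let G : Fin (r + 1) → P k r := fun i => (fcs.get (Fin.cast hfcslen.symm i)).1
  let d : Fin (r + 1) → ℕ := fun i => (fcs.get (Fin.cast hfcslen.symm i)).2
  have hmemfcs : ∀ fc ∈ fcs, fc.1.IsHomogeneous fc.2 ∧ 0 < fc.2 := by
    intro fc hfc
    rw [hfcs, List.mem_append, List.mem_singleton] at hfc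
    rcases hfc with hfc | rfl
    · exact ⟨hhom fc hfc, hpos fc hfc⟩
    · exact ⟨hℓ1, one_pos⟩
  have hG : ∀ i, (G i).IsHomogeneous (d i) := fun i => (hmemfcs _ (List.get_mem _ _)).1
  have hd : ∀ i, 0 < d i := fun i => (hmemfcs _ (List.get_mem _ _)).2
  have hofFn : List.ofFn G = fcs.map Prod.fst := by
    apply List.ext_get
    · rw [List.length_ofFn, List.length_map, hfcslen]
    · intro n h₁ h₂
      rw [List.get_ofFn]
      simp [G]
  have hfst : fcs.map Prod.fst = fs.map Prod.fst ++ [ℓ] := by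
    rw [hfcs, List.map_append]; rfl
  -- the prefix-regularity of `G` in the ideal language
  have hreg' : ∀ (n : ℕ) (hn : n < r + 1) (u : P k r),
      G ⟨n, hn⟩ * u ∈ Ideal.ofList ((List.ofFn G).take n) →
        u ∈ Ideal.ofList ((List.ofFn G).take n) := by
    intro n hn u hu
    rw [hofFn, hfst] at hu ⊢
    have hGn' : G ⟨n, hn⟩ = (fcs.map Prod.fst)[n]'(by rw [List.length_map, hfcslen]; exact hn) := by
      simp [G, List.getElem_map]
    have hGn : G ⟨n, hn⟩ = (fs.map Prod.fst ++ [ℓ])[n]'(by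
        rw [List.length_append, List.length_map, hlen]; exact hn) := by
      rw [hGn']
      exact List.getElem_of_eq hfst _
    rcases Nat.lt_succ_iff_lt_or_eq.1 hn with hlt | heq
    · -- one of the `f_i`: weakly regular on `S^{pt}`
      have hlt' : n < (fs.map Prod.fst).length := by rw [List.length_map, hlen]; exact hlt
      rw [List.take_append_of_le_length hlt'.le] at hu ⊢
      rw [hGn, List.getElem_append_left hlt'] at hu
      have hw := (isSMulRegular_quotient_iff_mem_of_smul_mem _ _).mp (hreg.regular_mod_prev n hlt')
        (fun _ : Unit => u)
      exact (mem_ideal_smul_top_iff _ _).1 (hw ((mem_ideal_smul_top_iff _ _).2 hu))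
    · -- `ℓ`: regular modulo `(f_1, …, f_r)S^{pt}`
      have hle : (fs.map Prod.fst).length ≤ n := by rw [List.length_map, hlen, heq]
      rw [List.take_append_of_le_length (by rw [List.length_map, hlen, heq]),
        List.take_of_length_le hle] at hu ⊢
      rw [hGn, List.getElem_append_right hle] at hu
      have hℓn : ([ℓ] : List (P k r))[n - (fs.map Prod.fst).length]'(by
          rw [List.length_map, hlen, heq, Nat.sub_self]; exact Nat.zero_lt_one) = ℓ := by
        simp [hlen, heq]
      rw [hℓn] at hu
      have hw := hℓreg (fun _ : Unit => u)
      exact (mem_ideal_smul_top_iff _ _).1 (hw ((mem_ideal_smul_top_iff _ _).2 hu))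
  have hAG := isArtinianGorenstein_span_of_forall_mul_mem G d hG hd hreg'
  -- the socle degree `Σ (d_i - 1) = a + b`
  have hσ : ∑ i, (d i - 1) = a + b := by
    have h1 : ∑ i, (d i - 1) + (r + 1) = ∑ i, d i := by
      have h := (Finset.sum_add_distrib (s := (Finset.univ : Finset (Fin (r + 1))))
        (f := fun i => d i - 1) (g := fun _ => 1)).symm.trans
        (Finset.sum_congr rfl fun i _ => Nat.sub_add_cancel (hd i))
      simpa using h
    have h2 : ∑ i, d i = (fcs.map Prod.snd).sum := by
      have : List.ofFn d = fcs.map Prod.snd := by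
        apply List.ext_get
        · rw [List.length_ofFn, List.length_map, hfcslen]
        · intro n h₁ h₂
          rw [List.get_ofFn]
          simp [d]
      rw [← this, List.sum_ofFn]
    have h3 : (fcs.map Prod.snd).sum = (fs.map Prod.snd).sum + 1 := by
      rw [hfcs, List.map_append, List.sum_append]; rfl
    omega
  -- the span of `G` is `(f_1, …, f_r, ℓ)`
  have hspan : Ideal.span (Set.range G) = Ideal.ofList (fs.map Prod.fst ++ [ℓ]) := by
    rw [← hfst, ← hofFn, Ideal.ofList]
    congr 1
    ext x
    exact (List.mem_ofFn' G x).symm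
  have key := hAG.mem_of_forall_mul_mem' hσ.symm hg fun h' hh' => by
    rw [hspan, ← mem_ideal_smul_top_iff _ (fun _ : Unit => g * h'),
      ofList_append_singleton_smul_top]
    exact H h' hh'
  rw [hspan, ← mem_ideal_smul_top_iff _ (fun _ : Unit => g), ofList_append_singleton_smul_top] at key
  exact key

/-! ### Linear algebra: a subspace of codimension `≤ 1` inside another -/

/-- For `A ≤ B` with `dim B ≤ dim A + 1` and `w₂ ∈ B ∖ A`: `B = A + k w₂`, so every `w₁ ∈ B` is
`≡ c w₂ (mod A)`. [folklore] -/
private theorem exists_sub_smul_mem_of_finrank_le {V : Type*} [AddCommGroup V] [Module k V]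
    [FiniteDimensional k V] {A B : Submodule k V} (hAB : A ≤ B)
    (hfin : Module.finrank k B ≤ Module.finrank k A + 1) {w₁ w₂ : V} (hw₁ : w₁ ∈ B) (hw₂ : w₂ ∈ B)
    (hw₂A : w₂ ∉ A) : ∃ c : k, w₁ - c • w₂ ∈ A := by
  have hw₂0 : w₂ ≠ 0 := fun h => hw₂A (h ▸ A.zero_mem)
  have hinf : A ⊓ (k ∙ w₂) = ⊥ := by
    rw [eq_bot_iff]
    intro x hx
    obtain ⟨hxA, hxw⟩ := Submodule.mem_inf.1 hx
    obtain ⟨c, rfl⟩ := Submodule.mem_span_singleton.1 hxw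
    by_cases hc : c = 0
    · rw [hc, zero_smul]; exact Submodule.zero_mem _
    · exact absurd (by simpa [hc] using A.smul_mem c⁻¹ hxA : w₂ ∈ A) hw₂A
  have hdim : Module.finrank k ↥(A ⊔ (k ∙ w₂)) = Module.finrank k A + 1 := by
    have h := Submodule.finrank_sup_add_finrank_inf_eq A (k ∙ w₂)
    rw [hinf, finrank_bot, add_zero, finrank_span_singleton hw₂0] at h
    exact h
  have hle : A ⊔ (k ∙ w₂) ≤ B := sup_le hAB ((Submodule.span_singleton_le_iff_mem _ _).2 hw₂)
  have heq : A ⊔ (k ∙ w₂) = B := Submodule.eq_of_le_of_finrank_le hle (by rw [hdim]; exact hfin)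
  rw [← heq] at hw₁
  obtain ⟨a, ha, y, hy, rfl⟩ := Submodule.mem_sup.1 hw₁
  obtain ⟨c, rfl⟩ := Submodule.mem_span_singleton.1 hy
  exact ⟨c, by rwa [add_sub_cancel_right]⟩

/-! ### The Cayley–Bacharach theorem -/

variable [Infinite k]

/-- **The Cayley–Bacharach theorem for a complete-intersection zero-scheme `Z ⊂ ℙ^r`
(Eisenbud–Green–Harris, Thm. CB7 with the residual scheme a point; CB4/CB6 for reduced `Z`).**
Let `f_1, …, f_r ∈ S = k[x₀, …, x_r]` (`k` infinite, `r ≥ 1`) be forms of positive degrees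
`d_1, …, d_r`, weakly regular on `S` (so `Z = V(f_1, …, f_r)` is a zero-dimensional complete
intersection with ideal `I_Z = (f_1, …, f_r)`, saturated), of length `N` (the Hilbert polynomial of
`S ⧸ I_Z`; `N = Π d_i` by Bézout), and let `Z' ⊂ Z` be a closed subscheme of colength one: a graded
`K' ⊇ I_Z` with Hilbert polynomial `N - 1`. Then **every form of degree `n ≤ s = Σ d_i - r - 1`
vanishing on `Z'` vanishes on `Z`: `(K̄')_n = (I_Z)_n`** ("If `C` is any plane curve of degree
`d + e - 3` containing all but one point of `Γ = X_1 ∩ X_2`, then `C` contains all of `Γ`";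
`s = Σ d_i - n - 1` in `ℙ^n`). Proof (EGH §1.3–1.4): with a linear form `ℓ` regular modulo `I_Z` and
`K̄'`, `R = S ⧸ (f_1, …, f_r, ℓ)` is Artinian Gorenstein of socle degree `σ = s + 1`
(Macaulay, `CompleteIntersectionHilbertFunction`); the quotient `K̄' ⧸ I_Z` has dimension `≤ 1` in
each degree (`ℓ` acts injectively on it and its Hilbert polynomial is `1`); if `g ∈ (K̄')_n ∖ I_Z`
with `n` minimal and `n ≤ s`, then for every form `h` of degree `σ - n ≥ 1`, `g h ≡ c·g ℓ^{σ-n}`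
modulo `I_Z`, so `g h ∈ (I_Z, ℓ)`, whence `g ∈ (I_Z, ℓ)` by the pairing, `g = k + ℓ g_1` with
`ℓ g_1 ∈ K̄'`, `g_1 ∈ (K̄')_{n-1} = (I_Z)_{n-1}`, `g ∈ I_Z` — a contradiction.
[cite: EisenbudGreenHarris1996, Thm. CB7, Thm. CB4, Thm. CB6, Thm. CB8]
[cite: Hartshorne1977, III Thm. 7.6, II Ex. 8.4 (p. 188)] -/
theorem degPiece_sat_eq_of_completeIntersection_colength_one (hr : 1 ≤ r) (fs : List (P k r × ℕ))
    (hlen : fs.length = r) (hhom : ∀ fc ∈ fs, fc.1.IsHomogeneous fc.2) (hpos : ∀ fc ∈ fs, 0 < fc.2)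
    (hreg : IsWeaklyRegular (Unit → P k r) (fs.map Prod.fst))
    {K' : Submodule (P k r) (Unit → P k r)} (hK' : IsGraded (fun _ : Unit => (0 : ℤ)) K')
    (hle : Ideal.ofList (fs.map Prod.fst) • (⊤ : Submodule (P k r) (Unit → P k r)) ≤ K')
    {N N' : ℕ} (hNN' : N' + 1 = N)
    (hN : ∀ n : ℤ, ((∑ q ∈ Finset.range (r + 1), (-1 : ℤ) ^ q *
      (Module.finrank k ((quot (fun _ : Unit => (0 : ℤ))
        (Ideal.ofList (fs.map Prod.fst) • (⊤ : Submodule (P k r) (Unit → P k r))) n).homology q) :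
          ℤ) : ℤ) : ℚ) = (C (N : ℚ)).eval (n : ℚ))
    (hN' : ∀ n : ℤ, ((∑ q ∈ Finset.range (r + 1), (-1 : ℤ) ^ q *
      (Module.finrank k ((quot (fun _ : Unit => (0 : ℤ)) K' n).homology q) : ℤ) : ℤ) : ℚ) =
        (C (N' : ℚ)).eval (n : ℚ))
    {n : ℤ} (hn : n + r + 1 ≤ ((fs.map Prod.snd).sum : ℤ)) :
    degPiece (fun _ : Unit => (0 : ℤ)) (sat K') n =
      degPiece (fun _ : Unit => (0 : ℤ))
        (Ideal.ofList (fs.map Prod.fst) • (⊤ : Submodule (P k r) (Unit → P k r))) n := by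
  set e₀ : Unit → ℤ := fun _ => 0 with he₀
  set K : Submodule (P k r) (Unit → P k r) := Ideal.ofList (fs.map Prod.fst) • ⊤ with hKdef
  have hhom' : ∀ g ∈ fs.map Prod.fst, ∃ c : ℕ, g.IsHomogeneous c := by
    intro g hg
    obtain ⟨fc, hfc, rfl⟩ := List.mem_map.1 hg
    exact ⟨fc.2, hhom fc hfc⟩
  have hK : IsGraded e₀ K := isGraded_ofList_smul_top e₀ _ hhom'
  have hKsat : sat K = K :=
    sat_ofList_smul_top_eq hr _ hhom' hreg (by rw [List.length_map, hlen])
  have hKK' : K ≤ sat K' := hle.trans (le_sat K')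
  -- the total degree `Σ d_i ≥ r`
  have hsum : r ≤ (fs.map Prod.snd).sum := by
    have h := List.length_le_sum_of_one_le (fs.map Prod.snd) fun i hi => by
      obtain ⟨fc, hfc, rfl⟩ := List.mem_map.1 hi
      exact hpos fc hfc
    rwa [List.length_map, hlen] at h
  -- a linear form regular modulo `I_Z` and modulo `K̄'`
  obtain ⟨ℓ, hℓ0, hℓ1, hℓL, hregK, hregK'⟩ := exists_linearForm_regular_sat_pair K K'
  rw [hKsat] at hregK
  have hregKpow : ∀ (b : ℕ) (v : Unit → P k r), ℓ ^ b • v ∈ K → v ∈ K := by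
    intro b
    induction b with
    | zero => intro v hv; rwa [pow_zero, one_smul] at hv
    | succ b ih => intro v hv; rw [pow_succ, mul_smul] at hv; exact hregK _ (ih _ hv)
  -- finiteness of the graded pieces
  haveI hfinF : ∀ d : ℤ, Module.Finite k (Unit → (Ldeg k r (d - 0)).comap (toL k r).toLinearMap) :=
    fun d => moduleFinite_pi_comap_toL_Ldeg e₀ d
  -- `dim (K̄')_m - dim (I_Z)_m` is non-decreasing in `m` …
  have hmono : ∀ m : ℤ, Module.finrank k (degPiece e₀ (sat K') m) +
      Module.finrank k (degPiece e₀ K (m + 1)) ≤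
      Module.finrank k (degPiece e₀ (sat K') (m + 1)) + Module.finrank k (degPiece e₀ K m) := by
    intro m
    obtain ⟨ψ, hψ⟩ := exists_linearMap_mul e₀ ℓ hℓL m (m + 1) rfl
    have hψinj : Function.Injective ψ := by
      intro x y hxy
      funext j
      apply Subtype.ext
      have h := congr_arg (fun z => ((z j : _) : P k r)) hxy
      simp only [hψ] at h
      exact mul_left_cancel₀ hℓ0 h
    have h1 : Module.finrank k ↥((degPiece e₀ (sat K') m).map ψ) =
        Module.finrank k (degPiece e₀ (sat K') m) :=
      (Submodule.equivMapOfInjective ψ hψinj _).finrank_eq.symm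
    have h2 : Module.finrank k ↥((degPiece e₀ K m).map ψ) = Module.finrank k (degPiece e₀ K m) :=
      (Submodule.equivMapOfInjective ψ hψinj _).finrank_eq.symm
    have hsup : (degPiece e₀ (sat K') m).map ψ ⊔ degPiece e₀ K (m + 1) ≤
        degPiece e₀ (sat K') (m + 1) :=
      sup_le (Submodule.map_le_iff_le_comap.2 fun q hq =>
        linearMap_mul_mem_degPiece e₀ (sat K') hψ hq) (degPiece_mono e₀ hKK' _)
    have hinf : (degPiece e₀ (sat K') m).map ψ ⊓ degPiece e₀ K (m + 1) ≤ (degPiece e₀ K m).map ψ := by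
      rintro x ⟨⟨q, hq, rfl⟩, hx⟩
      exact ⟨q, (linearMap_mul_mem_degPiece_iff e₀ K hregK hψ q).1 hx, rfl⟩
    have h := Submodule.finrank_sup_add_finrank_inf_eq ((degPiece e₀ (sat K') m).map ψ)
      (degPiece e₀ K (m + 1))
    have h3 := Submodule.finrank_mono hsup
    have h4 := Submodule.finrank_mono hinf
    rw [h1] at h; rw [h2] at h4
    omega
  -- … hence at most its eventual value `N - N' = 1`
  obtain ⟨n₁, hn₁⟩ := exists_forall_finrank_quotient_degPiece_sat_eq_length e₀ hr hK hN
  obtain ⟨n₂, hn₂⟩ := exists_forall_finrank_quotient_degPiece_sat_eq_length e₀ hr hK' hN'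
  rw [hKsat] at hn₁
  have hjump : ∀ m : ℤ, Module.finrank k (degPiece e₀ (sat K') m) ≤
      Module.finrank k (degPiece e₀ K m) + 1 := by
    intro m
    have hiter : ∀ j : ℕ, Module.finrank k (degPiece e₀ (sat K') m) +
        Module.finrank k (degPiece e₀ K (m + j)) ≤
        Module.finrank k (degPiece e₀ (sat K') (m + j)) + Module.finrank k (degPiece e₀ K m) := by
      intro j
      induction j with
      | zero => rw [Nat.cast_zero, add_zero, add_comm]
      | succ j ih =>
        have h := hmono (m + j)
        have e1 : m + ((j + 1 : ℕ) : ℤ) = m + j + 1 := by push_cast; ring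
        rw [e1]
        omega
    obtain ⟨j, hj⟩ : ∃ j : ℕ, n₁ ≤ m + j ∧ n₂ ≤ m + j :=
      ⟨(n₁ - m).toNat + (n₂ - m).toNat, by push_cast; omega, by push_cast; omega⟩
    have hA := Submodule.finrank_quotient_add_finrank (degPiece e₀ K (m + j))
    have hB := Submodule.finrank_quotient_add_finrank (degPiece e₀ (sat K') (m + j))
    rw [hn₁ _ hj.1] at hA
    rw [hn₂ _ hj.2] at hB
    have h := hiter j
    omega
  -- the socle degree `σ = Σ d_i - r`
  obtain ⟨σ, hσ⟩ : ∃ σ : ℕ, (σ : ℤ) + r = ((fs.map Prod.snd).sum : ℤ) :=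
    ⟨(fs.map Prod.snd).sum - r, by push_cast [Nat.cast_sub hsum]; ring⟩
  -- the inductive core: `(K̄')_{t-1} = (I_Z)_{t-1}` and `t ≤ s` imply `(K̄')_t = (I_Z)_t`
  have core : ∀ (t : ℕ) (m : ℤ), m + 1 = t → degPiece e₀ (sat K') m ≤ degPiece e₀ K m →
      (t : ℤ) + r + 1 ≤ ((fs.map Prod.snd).sum : ℤ) → degPiece e₀ (sat K') t ≤ degPiece e₀ K t := by
    intro t m hmt ih ht q hq
    by_contra hqK
    rw [mem_degPiece] at hq hqK
    -- `b = σ - t ≥ 1`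
    obtain ⟨b', hb'⟩ : ∃ b' : ℕ, (t : ℤ) + (b' + 1) = σ := ⟨σ - t - 1, by omega⟩
    set b : ℕ := b' + 1 with hbdef
    set g : P k r := (q () : P k r) with hgdef
    have hgL : toL k r g ∈ Ldeg k r t := by
      have h2 : (q () : P k r) ∈ (Ldeg k r ((t : ℤ) - e₀ ())).comap (toL k r).toLinearMap :=
        (q ()).2
      rw [Submodule.mem_comap] at h2
      have e1 : Ldeg k r ((t : ℤ) - e₀ ()) = Ldeg k r t := by rw [he₀, sub_zero]
      exact e1.le h2
    have hg : g.IsHomogeneous t := (toL_mem_Ldeg_iff g t).1 hgL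
    have hℓbL : toL k r (ℓ ^ b) ∈ Ldeg k r (b : ℤ) := by
      rw [toL_mem_Ldeg_iff]; simpa using hℓ1.pow b
    -- multiplication by `ℓ^b` and by a form `h` of degree `b`: `(F)_t → (F)_σ`
    obtain ⟨ψ, hψ⟩ := exists_linearMap_mul e₀ (ℓ ^ b) hℓbL (t : ℤ) σ (by omega)
    have hw₂ : ψ q ∈ degPiece e₀ (sat K') σ := linearMap_mul_mem_degPiece e₀ (sat K') hψ hq
    have hw₂A : ψ q ∉ degPiece e₀ K σ := fun h =>
      hqK ((linearMap_mul_mem_degPiece_iff e₀ K (hregKpow b) hψ q).1 h)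
    have H : ∀ h : P k r, h.IsHomogeneous b → (fun _ : Unit => g * h) ∈ K ⊔ ℓ • ⊤ := by
      intro h hh
      have hhL : toL k r h ∈ Ldeg k r (b : ℤ) := (toL_mem_Ldeg_iff h b).2 hh
      obtain ⟨θ, hθ⟩ := exists_linearMap_mul e₀ h hhL (t : ℤ) σ (by omega)
      have hw₁ : θ q ∈ degPiece e₀ (sat K') σ := linearMap_mul_mem_degPiece e₀ (sat K') hθ hq
      obtain ⟨c, hc⟩ := exists_sub_smul_mem_of_finrank_le (degPiece_mono e₀ hKK' _) (hjump σ)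
        hw₁ hw₂ hw₂A
      rw [mem_degPiece] at hc
      have hval : (fun j => (((θ q - c • ψ q) j : _) : P k r)) =
          fun _ : Unit => h * g - MvPolynomial.C c * (ℓ ^ b * g) := by
        funext j
        rw [Pi.sub_apply, Pi.smul_apply, Submodule.coe_sub, Submodule.coe_smul, hθ, hψ,
          MvPolynomial.smul_eq_C_mul]
      rw [hval] at hc
      have heq : (fun _ : Unit => g * h) = (fun _ : Unit => h * g - MvPolynomial.C c * (ℓ ^ b * g)) +
          ℓ • (fun _ : Unit => MvPolynomial.C c * (ℓ ^ b' * g)) := by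
        funext u
        simp only [Pi.add_apply, Pi.smul_apply, smul_eq_mul, hbdef, pow_succ]
        ring
      rw [heq]
      exact Submodule.add_mem_sup hc (Submodule.smul_mem_pointwise_smul _ _ _ Submodule.mem_top)
    -- the Gorenstein pairing: `g ∈ (I_Z, ℓ)`
    have hgmem := const_mem_sup_smul_top_of_forall_mul fs hlen hhom hpos hreg hℓ1 hregK
      (a := t) (b := b) (by
        have h1 : ((t + b + r : ℕ) : ℤ) = ((fs.map Prod.snd).sum : ℤ) := by
          simp only [Nat.cast_add, hbdef, Nat.cast_one]; omega
        exact Nat.cast_inj.1 h1) hg H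
    -- degree-`t` components: `g = k₁ + ℓ v'` with `k₁ ∈ I_Z`, `v'` homogeneous of degree `t - 1`
    obtain ⟨k₁, hk₁, u, hu, hsum'⟩ := Submodule.mem_sup.1 hgmem
    obtain ⟨u', -, rfl⟩ := (Submodule.mem_smul_pointwise_iff_exists _ _ _).1 hu
    have hvq : (fun j => ((q j : _) : P k r)) = fun _ : Unit => g := by
      funext j; rfl
    have hdec : (fun _ : Unit => g) = projDeg e₀ t k₁ + ℓ • projDeg e₀ ((t : ℤ) - 1) u' := by
      have h := congr_arg (projDeg e₀ (t : ℤ)) hsum'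
      rw [map_add, projDeg_smul_of_mem_Ldeg e₀ hℓL, ← hvq, projDeg_coe_eq_self] at h
      rw [← hvq]; exact h.symm
    have hk₁t : projDeg e₀ t k₁ ∈ K := hK _ k₁ hk₁
    set v' : Unit → P k r := projDeg e₀ ((t : ℤ) - 1) u' with hv'def
    have hv'sat : v' ∈ sat K' := by
      refine hregK' v' ?_
      have : ℓ • v' = (fun _ : Unit => g) - projDeg e₀ t k₁ := by rw [hdec]; abel
      rw [this]
      exact Submodule.sub_mem _ (hvq ▸ hq) (hKK' hk₁t)
    -- `v' ∈ (K̄')_{t-1} = (I_Z)_{t-1}`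
    have hv'hom : IsHomog e₀ m v' := by
      rw [show m = (t : ℤ) - 1 by omega]
      exact projDeg_projDeg e₀ _ u'
    rw [isHomog_iff_forall_toL_mem_Ldeg] at hv'hom
    let q' : Unit → (Ldeg k r (m - 0)).comap (toL k r).toLinearMap :=
      fun j => ⟨v' j, by rw [Submodule.mem_comap]; exact hv'hom j⟩
    have hq' : q' ∈ degPiece e₀ (sat K') m := by
      rw [mem_degPiece]; exact hv'sat
    have hv'K : v' ∈ K := by
      have := ih hq'
      rw [mem_degPiece] at this
      exact this
    apply hqK
    rw [hvq, hdec]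
    exact K.add_mem hk₁t (K.smul_mem ℓ hv'K)
  -- induction on `t = n ≥ 0`; negative degrees are trivial
  have main : ∀ t : ℕ, (t : ℤ) + r + 1 ≤ ((fs.map Prod.snd).sum : ℤ) →
      degPiece e₀ (sat K') t ≤ degPiece e₀ K t := by
    intro t
    induction t with
    | zero =>
      intro ht
      refine core 0 (-1) (by norm_num) (fun q _ => ?_) ht
      haveI : ∀ _i : Unit, Module.Finite k ((Ldeg k r (-1 - 0)).comap (toL k r).toLinearMap) :=
        fun _ => moduleFinite_comap_toL_Ldeg _
      haveI : Subsingleton (Unit → (Ldeg k r (-1 - 0)).comap (toL k r).toLinearMap) := by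
        rw [← Module.finrank_zero_iff (R := k), Module.finrank_pi_fintype, Finset.sum_eq_zero_iff]
        intro j _
        rw [finrank_comap_toL_Ldeg, if_neg (by norm_num)]
      rw [Subsingleton.elim q 0]
      exact Submodule.zero_mem _
    | succ t ih =>
      intro ht
      exact core (t + 1) t (by push_cast; ring) (ih (by push_cast at ht ⊢; omega)) ht
  rcases lt_or_ge n 0 with hn0 | hn0
  · haveI : ∀ _i : Unit, Module.Finite k ((Ldeg k r (n - 0)).comap (toL k r).toLinearMap) :=
      fun _ => moduleFinite_comap_toL_Ldeg _
    haveI : Subsingleton (Unit → (Ldeg k r (n - 0)).comap (toL k r).toLinearMap) := by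
      rw [← Module.finrank_zero_iff (R := k), Module.finrank_pi_fintype, Finset.sum_eq_zero_iff]
      intro j _
      rw [finrank_comap_toL_Ldeg, if_neg (by omega)]
    exact le_antisymm (fun q _ => by rw [Subsingleton.elim q 0]; exact Submodule.zero_mem _)
      (degPiece_mono e₀ hKK' _)
  · obtain ⟨t, rfl⟩ := Int.eq_ofNat_of_zero_le hn0
    exact le_antisymm (main t hn) (degPiece_mono e₀ hKK' _)

/-- **Cayley–Bacharach, with Bézout's `deg Z = Π d_i` supplied** (`ProjectiveCompleteIntersectionBezout`):
for the complete intersection `Z = V(f_1, …, f_r) ⊂ ℙ^r` of forms of positive degrees `d_i`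
(weakly regular) and a closed subscheme `Z' = V(K') ⊂ Z` of length `Π d_i - 1`, every form of
degree `≤ Σ d_i - r - 1` vanishing on `Z'` vanishes on `Z`.
[cite: EisenbudGreenHarris1996, Thm. CB7, Thm. CB6] [cite: Hartshorne1977, I Thm. 7.7 (p. 53)] -/
theorem degPiece_sat_eq_of_completeIntersection_length_pred (hr : 1 ≤ r) (fs : List (P k r × ℕ))
    (hlen : fs.length = r) (hhom : ∀ fc ∈ fs, fc.1.IsHomogeneous fc.2) (hpos : ∀ fc ∈ fs, 0 < fc.2)
    (hreg : IsWeaklyRegular (Unit → P k r) (fs.map Prod.fst))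
    {K' : Submodule (P k r) (Unit → P k r)} (hK' : IsGraded (fun _ : Unit => (0 : ℤ)) K')
    (hle : Ideal.ofList (fs.map Prod.fst) • (⊤ : Submodule (P k r) (Unit → P k r)) ≤ K')
    (hN' : ∀ n : ℤ, ((∑ q ∈ Finset.range (r + 1), (-1 : ℤ) ^ q *
      (Module.finrank k ((quot (fun _ : Unit => (0 : ℤ)) K' n).homology q) : ℤ) : ℤ) : ℚ) =
        (C (((fs.map Prod.snd).prod - 1 : ℕ) : ℚ)).eval (n : ℚ))
    {n : ℤ} (hn : n + r + 1 ≤ ((fs.map Prod.snd).sum : ℤ)) :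
    degPiece (fun _ : Unit => (0 : ℤ)) (sat K') n =
      degPiece (fun _ : Unit => (0 : ℤ))
        (Ideal.ofList (fs.map Prod.fst) • (⊤ : Submodule (P k r) (Unit → P k r))) n := by
  have hhom' : ∀ g ∈ fs.map Prod.fst, ∃ c : ℕ, g.IsHomogeneous c := by
    intro g hg
    obtain ⟨fc, hfc, rfl⟩ := List.mem_map.1 hg
    exact ⟨fc.2, hhom fc hfc⟩
  have hprod : 1 ≤ (fs.map Prod.snd).prod := by
    refine Nat.succ_le_of_lt (List.prod_pos fun d hd => ?_)
    obtain ⟨fc, hfc, rfl⟩ := List.mem_map.1 hd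
    exact hpos fc hfc
  refine degPiece_sat_eq_of_completeIntersection_colength_one hr fs hlen hhom hpos hreg hK' hle
    (N := (fs.map Prod.snd).prod) (Nat.sub_add_cancel hprod) (fun m => ?_) hN' hn
  rw [eulerChar_completeIntersection_dimZero hr _ hhom' hreg (by rw [List.length_map, hlen]) m,
    finrank_homology_zero_completeIntersection_dimZero hr fs hhom hreg hlen m, eval_C, Int.cast_natCast]

/-- **Cayley–Bacharach in the plane (Eisenbud–Green–Harris Thm. CB4, scheme-theoretically; Chasles'
theorem CB3 for `d = e = 3`).** Let `f, g ∈ k[x₀, x₁, x₂]` be forms of positive degrees `d, e`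
without common factor (`[f, g]` weakly regular), so that `Z = V(f, g)` is a zero-scheme of length
`d e`, and let `Z' = V(K') ⊂ Z` be a closed subscheme of length `d e - 1`. Then every plane curve of
degree `n ≤ d + e - 3` containing `Z'` contains `Z`: `(K̄')_n = (f, g)_n` ("If `C ⊂ ℙ²` is any
plane curve of degree `d + e - 3` containing all but one point of `Γ`, then `C` contains all of
`Γ`"). [cite: EisenbudGreenHarris1996, Thm. CB4, Thm. CB3, Thm. CB5]
[cite: SilvermanTate2015, Appendix A Thm. A.2 (pp. 232–234)] -/
theorem degPiece_sat_eq_of_planeCurves_length_pred {f g : P k 2} {d e : ℕ}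
    (hf : f.IsHomogeneous d) (hg : g.IsHomogeneous e) (hd : 0 < d) (he : 0 < e)
    (hreg : IsWeaklyRegular (Unit → P k 2) [f, g])
    {K' : Submodule (P k 2) (Unit → P k 2)} (hK' : IsGraded (fun _ : Unit => (0 : ℤ)) K')
    (hle : Ideal.ofList [f, g] • (⊤ : Submodule (P k 2) (Unit → P k 2)) ≤ K')
    (hN' : ∀ n : ℤ, ((∑ q ∈ Finset.range (2 + 1), (-1 : ℤ) ^ q *
      (Module.finrank k ((quot (fun _ : Unit => (0 : ℤ)) K' n).homology q) : ℤ) : ℤ) : ℚ) =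
        (C ((d * e - 1 : ℕ) : ℚ)).eval (n : ℚ))
    {n : ℤ} (hn : n + 3 ≤ (d : ℤ) + e) :
    degPiece (fun _ : Unit => (0 : ℤ)) (sat K') n =
      degPiece (fun _ : Unit => (0 : ℤ))
        (Ideal.ofList [f, g] • (⊤ : Submodule (P k 2) (Unit → P k 2))) n := by
  have h := degPiece_sat_eq_of_completeIntersection_length_pred (k := k) (r := 2) (by norm_num)
    [(f, d), (g, e)] rfl (by simp [hf, hg]) (by simp [hd, he]) (by simpa using hreg) hK'
    (by simpa using hle) (by simpa using hN') (n := n) (by push_cast; simp; omega)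
  simpa using h

end LaurentCech

end Literature.Algebra.Homology

end
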